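import Summits.HodgeConjecture.HodgeConjecture.Theorems.K2LiuInertHeckeTransversalBorel
import Summits.HodgeConjecture.HodgeConjecture.Theorems.K2LiuHyperbolicFrameVectors
import Literature.NumberTheory.GelbartRogawski1991.LocalDoubledUnitaryLagrangians
import Literature.NumberTheory.GelbartRogawski1991.UnitaryDualPairLocalReferenceSection
import Literature.NumberTheory.GelbartRogawski1991.UnitaryDualPairThetaKernelCM
import Literature.NumberTheory.Automorphic.Liu2021.Def411WeilCarriers
import Literature.NumberTheory.Automorphic.UnitaryGroupDualPairLocalLine
import Literature.NumberTheory.Automorphic.UnitaryGroupNonsplitPlace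
import Literature.NumberTheory.Automorphic.AnisotropicUnitaryGroupCompactOfPlace   -- ★ `conjLocal_apply_eq_of_smul_eq`

/-!
# The frame inputs `(y, y*)`, `(hgy)`, `y^⊥ = S·y` of the swap/Siegel brick ★ (C3′) along the Hecke transversal of `K_v t₁ K_v`, at an INERT unramified
# place of the K2Lit curve datum (LOCAL SEAM of s23, inert package, organ (L24-b) (F2))

Track B ∕ K2-LIT, hLiu418 = stmt-HodgeConjecture-24832; LEAD F0P6-plan (g11) «M-155g» (ii) ∕ «M-155i»: (L24-b) «eigenvalue of `T(t₁)` on `[𝟙_𝒪]`» by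
ROAD A′ = (T) ★ `K2LiuInertHeckeTransversalBorel` → **(F2) this file** → (Λ-functional) → (Σ). Helper (count-neutral, own head per LEAD R3); words
`K2/K2Liu-p01/g3/INERT-SOCKETS-v2.K2Liup01g3.md` §3. THEOREMS ONLY (no `def`, no instance, no notation, no named fact, no `sorry`).

Setting (★ (C3′) `F0P2oDoubledSwapSiegel.exists_involution_forall_isSiegelDelta`, generic `n`): `S := L ⊗ L⁺_v = Π_{w' ∣ v} L_{w'}` (`LocalRing`),
`σ_S = c ⊗ 1` (`conjLocal`), the pair `𝕎 = V ⊗ W`, `V = ⟨dV⟩` (`N = 2`), `W = ⟨a⟩`, enumerated by `e₁ : Fin 2 × Fin 1 ≃ Fin n′`, with `S`-Gram matrix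
`G = gramS (gram e₁ diag(dV) (a))` and pairing `h = hermForm σ_S G`; the group `U(V)(L⁺_v) = localPi … 2 diag(dV) v` acts on `S^{n′}` through
★ `localLineInl` (`x ↦ x ⊗ 1_W`) and ★ `localPiEquiv` (matrix over `S`).  At an INERT place `v` (one place `w`, `S = L_w` a field) with the integral
hyperbolic frame `T` of ★ (T) (`diag(dV)_w = σ_w(T)ᵀ·antidiag(1,1)·T`):

* §1 generic complements to ★ `K2LiuHyperbolicFrameVectors`: `hermForm_formCongr_frameVec_left` (`h(T⁻¹eᵢ, β) = (A·T·β)ᵢ`), the `N = 2` line lemma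
  `eq_smul_frameVec_of_hermForm_eq_zero` (`h(T⁻¹e₀, β) = 0 ⇒ β = (Tβ)₀ · T⁻¹e₀` for `A = antidiag`), `exists_mulVec_eq_add_smul_of_line` (`(hgb)` from
  `(hgy)` and `y^⊥ = S·y`);
* §2 ONE-PLACE READINGS (any CM-type `E/F`, any `N`): the `w`-component of `(x ⊗ 1_W)·Y` is `reindex e (x_w ⊗ 1)·Y_w` (`apply_mulVec_localLineInl`), of
  `h(Y, Y′)` is `h_w(Y_w, Y′_w)` at a non-split place (`apply_hermForm_of_smul_eq`, via ★ `conjLocal_apply_eq_of_smul_eq`), and `G` read at `w` is the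
  place form (`gramS_map_evalRingHom`);
* §3 **`exists_frameInputs_inert`** — THE (F2) PACKAGE: the transversal `X₊ ∪ X₀ ∪ {t₁⁻¹}` of ★ (T) (`|X₊| = q_v²`, `|X₀| = q_v − 1`) together with
  `y, y* : Fin n′ → S` (`y_w = T⁻¹e₀ ⊗ 1`, `y*_w = a⁻¹·T⁻¹e₁ ⊗ 1`): `h(y,y) = 0`, `h(y*,y) = h(y,y*) = 1`, `y^⊥ = S·y`, and scalars `α₊, α₋ ∈ S` with
  `(α₊)_w = ϖ`, `(α₋)_w = ϖ⁻¹` such that `(x ⊗ 1)·y = α₊·y ∣ y ∣ α₋·y` for `x ∈ X₊ ∣ X₀ ∣ {t₁⁻¹}` — with §1's `exists_mulVec_eq_add_smul_of_line` these are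
  literally the hypotheses `hyy hsy hys (hgy) (hgb)` of ★ (C3′) for every member of the Hecke sum `T(t₁) = Σ_x x·K_v` (ROAD A′, (Λ-functional) next).
[GelbartRogawski1991, §3.2 (3.2.2) p. 457]; [Kudla1994, §2–§3 Thm. 3.1]; [MoeglinVignerasWaldspurger1987, Chap. 1 I.17]; [BruhatTits1972, (4.4.4)].
HONEST LABEL: HC_CM is proved only modulo the printed citations (2 remaining named inputs: hLiu418 = stmt-HodgeConjecture-24832, h413 =
stmt-HodgeConjecture-24833) until rung 0 closes; this file is unconditional and moves no counter.
-/

set_option autoImplicit false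

set_option linter.dupNamespace false

noncomputable section

open scoped Matrix Kronecker Pointwise Valued
open NumberField IsDedekindDomain Matrix MulAction

namespace Summit.HodgeConjecture.HodgeConjecture.Cruxes.HLiu418.K2LiuInertFrameInputs

open Literature.NumberTheory.Automorphic Literature.NumberTheory.Automorphic.UnitaryGroup Literature.NumberTheory.Automorphic.HermitianLattice
open Literature.NumberTheory.Automorphic.Liu2021 Literature.NumberTheory.Automorphic.Liu2021.Def411WeilCarriers
open Literature.NumberTheory.GelbartRogawski1991 Literature.NumberTheory.GelbartRogawski1991.GRConstruction
open Literature.NumberTheory.GelbartRogawski1991.UnitaryDualPair Literature.NumberTheory.GelbartRogawski1991.UnitaryDualPair.LocalSplitting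
open Literature.NumberTheory.GaloisRepresentations
open Summit.HodgeConjecture.HodgeConjecture.Cruxes.HLiu418.K2LiuHyperbolicFrameVectors
open Summit.HodgeConjecture.HodgeConjecture.Cruxes.HLiu418.K2LiuInertHeckeTransversalBorel

/-! ## §1 Generic complements: the frame vector against an arbitrary vector, the `N = 2` line, `(hgb)` from `(hgy)` -/

section Generic

variable {R : Type*} [CommRing R] (σ : R →+* R) {n : ℕ}

/-- **`h(T⁻¹eᵢ, β) = (A·(Tβ))ᵢ`** for `H = σ(T)ᵀ A T`: the frame vector pairs with an arbitrary `β` through the frame coordinates `Tβ`.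
[cite: GelbartRogawski1991, §3.2 p. 457] -/
theorem hermForm_formCongr_frameVec_left (T : GL (Fin n) R) (A : Matrix (Fin n) (Fin n) R) (i : Fin n) (β : Fin n → R) :
    hermForm σ (formCongr σ T A) (((T⁻¹ : GL (Fin n) R) : Matrix (Fin n) (Fin n) R) *ᵥ Pi.single i 1) β =
      (A *ᵥ ((T : Matrix (Fin n) (Fin n) R) *ᵥ β)) i := by
  have hσTT : ((T : Matrix (Fin n) (Fin n) R).map σ) * (((T⁻¹ : GL (Fin n) R) : Matrix (Fin n) (Fin n) R).map σ) = 1 :=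
    GLn.map_val_mul_map_val_inv σ T
  have hσx : (σ : R → R) ∘ (((T⁻¹ : GL (Fin n) R) : Matrix (Fin n) (Fin n) R) *ᵥ Pi.single i 1) =
      (((T⁻¹ : GL (Fin n) R) : Matrix (Fin n) (Fin n) R).map σ) *ᵥ Pi.single i 1 := by
    funext k
    rw [Function.comp_apply, RingHom.map_mulVec, comp_single_one]
  unfold hermForm formCongr
  rw [hσx, Matrix.mul_assoc, ← Matrix.mulVec_mulVec, Matrix.dotProduct_mulVec, Matrix.vecMul_transpose, Matrix.mulVec_mulVec, hσTT,
    Matrix.one_mulVec, single_one_dotProduct, Matrix.mulVec_mulVec]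

/-- a vector of `R²` in the standard basis: `z = z₀ e₀ + z₁ e₁`. [folklore] -/
theorem eq_add_single_two (z : Fin 2 → R) : z = z 0 • (Pi.single 0 1 : Fin 2 → R) + z 1 • (Pi.single 1 1 : Fin 2 → R) := by
  funext k
  fin_cases k <;> simp

/-- **The `N = 2` line lemma**: for the hyperbolic frame `H = σ(T)ᵀ·antidiag(1,1)·T` and `y₀ = T⁻¹e₀`, `h(y₀, β) = (Tβ)₁`, so `h(y₀, β) = 0` forces
`β = (Tβ)₀ · y₀` — `y₀^⊥ = R·y₀`. [cite: Dieudonne1971GroupesClassiques, Chap. II §5] [cite: Kudla1994, §2] -/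
theorem eq_smul_frameVec_of_hermForm_eq_zero (T : GL (Fin 2) R) (β : Fin 2 → R)
    (h : hermForm σ (formCongr σ T ((StdForm.antidiagonal 2).over R)) (((T⁻¹ : GL (Fin 2) R) : Matrix (Fin 2) (Fin 2) R) *ᵥ Pi.single 0 1) β = 0) :
    β = ((T : Matrix (Fin 2) (Fin 2) R) *ᵥ β) 0 • (((T⁻¹ : GL (Fin 2) R) : Matrix (Fin 2) (Fin 2) R) *ᵥ Pi.single 0 1) := by
  have hTT : ((T⁻¹ : GL (Fin 2) R) : Matrix (Fin 2) (Fin 2) R) * (T : Matrix (Fin 2) (Fin 2) R) = 1 := by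
    rw [← Units.val_mul, inv_mul_cancel, Units.val_one]
  have h1 : ((T : Matrix (Fin 2) (Fin 2) R) *ᵥ β) 1 = 0 := by
    rw [hermForm_formCongr_frameVec_left, Matrix.mulVec, dotProduct, Fin.sum_univ_two, StdForm.antidiagonal_over_apply,
      StdForm.antidiagonal_over_apply, if_neg (by decide), if_pos (by decide), zero_mul, zero_add, one_mul] at h
    exact h
  calc β = ((T⁻¹ : GL (Fin 2) R) : Matrix (Fin 2) (Fin 2) R) *ᵥ ((T : Matrix (Fin 2) (Fin 2) R) *ᵥ β) := by
        rw [Matrix.mulVec_mulVec, hTT, Matrix.one_mulVec]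
    _ = ((T : Matrix (Fin 2) (Fin 2) R) *ᵥ β) 0 • (((T⁻¹ : GL (Fin 2) R) : Matrix (Fin 2) (Fin 2) R) *ᵥ Pi.single 0 1) := by
        conv_lhs => rw [eq_add_single_two ((T : Matrix (Fin 2) (Fin 2) R) *ᵥ β)]
        rw [h1, zero_smul, add_zero, Matrix.mulVec_smul]

/-- **`(hgb)` from `(hgy)` on a line**: if `G y = α y` and every `b` with `P b` lies on the line `R·y`, then every such `b` has `G b = b + t·y`.
[cite: Kudla1994, §2] -/
theorem exists_mulVec_eq_add_smul_of_line {m : Type*} [Fintype m] (G : Matrix m m R) {y : m → R} {α : R} (hgy : G *ᵥ y = α • y)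
    {P : (m → R) → Prop} (hline : ∀ b, P b → ∃ s : R, b = s • y) (b : m → R) (hb : P b) : ∃ t : R, G *ᵥ b = b + t • y := by
  obtain ⟨s, rfl⟩ := hline b hb
  exact ⟨s * α - s, by rw [Matrix.mulVec_smul, hgy, smul_smul, sub_smul, add_sub_cancel]⟩

end Generic

/-! ## §2 One-place readings of `S = E ⊗ F_v = Π_{w ∣ v} E_w` -/

section OnePlace

variable {F E : Type} [Field F] [NumberField F] [Field E] [NumberField E] [Algebra F E] (c : E ≃ₐ[F] E)
  (N : ℕ) {m : ℕ} (e : Fin N × Fin 1 ≃ Fin m) (JV : Matrix (Fin N) (Fin N) E) (JW : Matrix (Fin 1) (Fin 1) E)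
  (v : HeightOneSpectrum (𝓞 F)) (w : PlacesOver E v)

/-- **The `w`-component of `(x ⊗ 1_W)·Y` is `reindex e (x_w ⊗ 1)·Y_w`** (★ `localLineInl`, ★ `localPiEquiv`, any place).
[cite: MoeglinVignerasWaldspurger1987, Chap. 1 I.17] -/
theorem apply_mulVec_localLineInl (x : localPi E c N JV v) (Y : Fin m → LocalRing E v) (b : Fin m) :
    ((((localPiEquiv E c m (Matrix.reindex e e (JV ⊗ₖ JW)) v (localLineInl E c N e JV JW v x)).1 :
          GL (Fin m) (LocalRing E v)).1) *ᵥ Y) b w =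
      (Matrix.reindex e e ((((x : LocalGLPi E N v) w : GL (Fin N) (w.1.adicCompletion E)) : Matrix (Fin N) (Fin N) (w.1.adicCompletion E)) ⊗ₖ
          (1 : Matrix (Fin 1) (Fin 1) (w.1.adicCompletion E))) *ᵥ fun b => Y b w) b := by
  have h := RingHom.map_mulVec (Pi.evalRingHom (fun w' : PlacesOver E v => w'.1.adicCompletion E) w)
    (((localPiEquiv E c m (Matrix.reindex e e (JV ⊗ₖ JW)) v (localLineInl E c N e JV JW v x)).1 :
          GL (Fin m) (LocalRing E v)).1) Y b
  rw [Pi.evalRingHom_apply] at h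
  rw [h, ← coe_localLineGL_apply E N e v (x : LocalGLPi E N v) w]
  rfl

/-- **The Gram matrix `G = T₀ ⊗ 1 ∈ M_n(S)` read at `w` is the place form of `T₀ ⊗ 1 ∈ M_n(E)`** (any place). [cite: HarrisKudlaSweet1996, §1 (1.9)] -/
theorem gramS_map_evalRingHom {n : ℕ} (T₀ : Matrix (Fin n) (Fin n) F) :
    (gramS F E v n T₀).map (Pi.evalRingHom (fun w' : PlacesOver E v => w'.1.adicCompletion E) w) = placeForm (T₀.map (algebraMap F E)) w.1 := by
  refine Matrix.ext fun i j => ?_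
  simp only [Matrix.map_apply, Pi.evalRingHom_apply, toLocalRing_apply, placeForm, HeightOneSpectrum.algebraMap_adicCompletion,
    Function.comp_apply, Algebra.algebraMap_self, RingHom.id_apply, toPlace_coe]

variable [Algebra.IsQuadraticExtension F E] (hc : c ≠ 1) (hw : c • w.1 = w.1)
include hc hw

/-- **`h(Y, Y′)` read at `w` is `h_w(Y_w, Y′_w)`** at a non-split place: `(hermForm σ_S G Y Y′)_w = hermForm σ_w G_w Y_w Y′_w`.
[cite: PlatonovRapinchuk1994, §5.1] -/
theorem apply_hermForm_of_smul_eq {n : ℕ} (G : Matrix (Fin n) (Fin n) (LocalRing E v)) (Y Y' : Fin n → LocalRing E v) :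
    hermForm (conjLocal E c v) G Y Y' w =
      hermForm (galAdicCompletionMap (L := E) c hw) (G.map (Pi.evalRingHom (fun w' : PlacesOver E v => w'.1.adicCompletion E) w))
        (fun b => Y b w) (fun b => Y' b w) := by
  have h1 : (Pi.evalRingHom (fun w' : PlacesOver E v => w'.1.adicCompletion E) w : LocalRing E v → w.1.adicCompletion E) ∘ ((conjLocal E c v : _ → _) ∘ Y) =
      (galAdicCompletionMap (L := E) c hw : _ → _) ∘ fun b => Y b w := by
    funext b
    exact conjLocal_apply_eq_of_smul_eq c hc v w hw (Y b)
  have h2 : (Pi.evalRingHom (fun w' : PlacesOver E v => w'.1.adicCompletion E) w : LocalRing E v → w.1.adicCompletion E) ∘ (G *ᵥ Y') =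
      G.map (Pi.evalRingHom (fun w' : PlacesOver E v => w'.1.adicCompletion E) w) *ᵥ fun b => Y' b w := by
    funext b
    exact RingHom.map_mulVec _ G Y' b
  rw [hermForm_apply, hermForm_apply, ← Pi.evalRingHom_apply (fun w' : PlacesOver E v => w'.1.adicCompletion E) w (_ ⬝ᵥ _), RingHom.map_dotProduct,
    h1, h2]

end OnePlace

/-! ## §3 The (F2) package at an inert unramified place of the K2Lit curve datum -/

section Inert

variable (L : Type) [Field L] [NumberField L] [IsCMField L]
variable (dV : Fin 2 → L) (v : HeightOneSpectrum (𝓞 (Fp L)))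

set_option maxHeartbeats 800000 in -- measured 2026-09-04 (as ★ (T) `exists_heckeTransversal_borel_inert`): the adelic unitary datum (`localPi`, `localInt`, quotient, orbits)
/-- **THE FRAME INPUTS OF ★ (C3′) ALONG THE HECKE TRANSVERSAL, INERT UNRAMIFIED PLACE** (organ (L24-b) (F2); see the module docstring): the transversal
`X₊ ∪ X₀ ∪ {t₁⁻¹}` of `K_v t₁ K_v ∕ K_v` of ★ (T) (`|X₊| = q_v²`, `|X₀| = q_v − 1`), a hyperbolic frame `(y, y*)` of `S^{n′} = (V ⊗ W) ⊗ L⁺_v` for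
`h = hermForm σ_S (gramS (gram e₁ diag(dV) (a)))` — `h(y,y) = 0`, `h(y*,y) = h(y,y*) = 1`, `y^⊥ = S·y` — and scalars `α₊`, `α₋` with `(α₊)_w = ϖ`,
`(α₋)_w = ϖ⁻¹`, such that `(x ⊗ 1_W)·y = α₊·y` (`x ∈ X₊`), `= 1·y` (`x ∈ X₀`), `= α₋·y` (`x = t₁⁻¹`) in ★ `localPiEquiv ∘ localLineInl` coordinates.
[cite: GelbartRogawski1991, §3.2 (3.2.2) p. 457] [cite: Kudla1994, §2–§3 Thm. 3.1] [cite: MoeglinVignerasWaldspurger1987, Chap. 1 I.17] [cite: BruhatTits1972, (4.4.4)] -/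
theorem exists_frameInputs_inert [DecidableEq (UnitaryGroup.localPi L (IsCMField.complexConj L) 2 (Matrix.diagonal dV) v)]
    (hdV : ∀ i, IsCMField.complexConj L (dV i) = dV i) {n' : ℕ} (e₁ : Fin 2 × Fin 1 ≃ Fin n') (a : (Fp L)ˣ)
    (w : UnitaryGroup.PlacesOver L v) (hw : IsCMField.complexConj L • w.1 = w.1)
    (hv : Algebra.IsUnramifiedIn (𝓞 L) v.asIdeal)
    {ϖ : w.1.adicCompletion L} (hϖ : Valued.v ϖ = WithZero.exp (-1 : ℤ))
    (hϖσ : galAdicCompletionMap (L := L) (IsCMField.complexConj L) hw ϖ = ϖ)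
    (T : GL (Fin 2) (w.1.adicCompletion L)) (hTi : T ∈ glInt 2 (w.1.adicCompletion L))
    (hTJ : UnitaryGroup.placeForm (Matrix.diagonal dV) w.1 =
      formCongr (galAdicCompletionMap (L := L) (IsCMField.complexConj L) hw) T ((StdForm.antidiagonal 2).over (w.1.adicCompletion L)))
    (t₁ : UnitaryGroup.localPi L (IsCMField.complexConj L) 2 (Matrix.diagonal dV) v)
    (ht₁ : Units.val ((t₁ : UnitaryGroup.LocalGLPi L 2 v) w) =
      ((T⁻¹ : GL (Fin 2) (w.1.adicCompletion L)) : Matrix (Fin 2) (Fin 2) (w.1.adicCompletion L)) *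
        Matrix.diagonal ![ϖ, ϖ⁻¹] * (T : Matrix (Fin 2) (Fin 2) (w.1.adicCompletion L))) :
    ∃ Xp X0 : Finset (UnitaryGroup.localPi L (IsCMField.complexConj L) 2 (Matrix.diagonal dV) v),
      Set.BijOn (fun x : UnitaryGroup.localPi L (IsCMField.complexConj L) 2 (Matrix.diagonal dV) v =>
          (x : UnitaryGroup.localPi L (IsCMField.complexConj L) 2 (Matrix.diagonal dV) v ⧸
            UnitaryGroup.localInt L (IsCMField.complexConj L) 2 (Matrix.diagonal dV) v))
        (Xp ∪ X0 ∪ {t₁⁻¹} : Finset _)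
        (orbit (UnitaryGroup.localInt L (IsCMField.complexConj L) 2 (Matrix.diagonal dV) v)
          (t₁ : UnitaryGroup.localPi L (IsCMField.complexConj L) 2 (Matrix.diagonal dV) v ⧸
            UnitaryGroup.localInt L (IsCMField.complexConj L) 2 (Matrix.diagonal dV) v)) ∧
      Xp.card = v.residueCard ^ 2 ∧ X0.card = v.residueCard - 1 ∧
      ∃ (y ys : Fin n' → UnitaryGroup.LocalRing L v) (αp αm : UnitaryGroup.LocalRing L v),
        hermForm (conjLocal L (IsCMField.complexConj L) v)
            (gramS (Fp L) L v n' (gram (Fp L) e₁ (realDiagonal L dV hdV) (TW (Fp L) a))) y y = 0 ∧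
        hermForm (conjLocal L (IsCMField.complexConj L) v)
            (gramS (Fp L) L v n' (gram (Fp L) e₁ (realDiagonal L dV hdV) (TW (Fp L) a))) ys y = 1 ∧
        hermForm (conjLocal L (IsCMField.complexConj L) v)
            (gramS (Fp L) L v n' (gram (Fp L) e₁ (realDiagonal L dV hdV) (TW (Fp L) a))) y ys = 1 ∧
        (∀ b : Fin n' → UnitaryGroup.LocalRing L v,
          hermForm (conjLocal L (IsCMField.complexConj L) v)
              (gramS (Fp L) L v n' (gram (Fp L) e₁ (realDiagonal L dV hdV) (TW (Fp L) a))) y b = 0 →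
            ∃ s : UnitaryGroup.LocalRing L v, b = s • y) ∧
        αp w = ϖ ∧ αm w = ϖ⁻¹ ∧
        (∀ x ∈ Xp,
          (((localPiEquiv L (IsCMField.complexConj L) n' (Matrix.reindex e₁ e₁ (Matrix.diagonal dV ⊗ₖ JW (Fp L) L a)) v
              (localLineInl L (IsCMField.complexConj L) 2 e₁ (Matrix.diagonal dV) (JW (Fp L) L a) v x)).1 :
              GL (Fin n') (UnitaryGroup.LocalRing L v)).1) *ᵥ y = αp • y) ∧
        (∀ x ∈ X0,
          (((localPiEquiv L (IsCMField.complexConj L) n' (Matrix.reindex e₁ e₁ (Matrix.diagonal dV ⊗ₖ JW (Fp L) L a)) v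
              (localLineInl L (IsCMField.complexConj L) 2 e₁ (Matrix.diagonal dV) (JW (Fp L) L a) v x)).1 :
              GL (Fin n') (UnitaryGroup.LocalRing L v)).1) *ᵥ y = (1 : UnitaryGroup.LocalRing L v) • y) ∧
        (((localPiEquiv L (IsCMField.complexConj L) n' (Matrix.reindex e₁ e₁ (Matrix.diagonal dV ⊗ₖ JW (Fp L) L a)) v
            (localLineInl L (IsCMField.complexConj L) 2 e₁ (Matrix.diagonal dV) (JW (Fp L) L a) v t₁⁻¹)).1 :
            GL (Fin n') (UnitaryGroup.LocalRing L v)).1) *ᵥ y = αm • y := by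
  classical
  haveI : Algebra.IsQuadraticExtension (Fp L) L := IsCMField.isQuadraticExtension L
  have hc : IsCMField.complexConj L ≠ 1 := IsCMField.complexConj_ne_one L
  -- ★ (T): the transversal and the frame eigen-relations at `w`
  obtain ⟨Xp, X0, hX, hcp, hc0, hXp, hX0, hti⟩ := heckeTransversal_mulVec_frameVec_inert L dV v w hw hv hϖ hϖσ T hTi hTJ t₁ ht₁
  set σ : w.1.adicCompletion L →+* w.1.adicCompletion L := galAdicCompletionMap (L := L) (IsCMField.complexConj L) hw with hσ
  set y₀ : Fin 2 → w.1.adicCompletion L :=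
    ((T⁻¹ : GL (Fin 2) (w.1.adicCompletion L)) : Matrix (Fin 2) (Fin 2) (w.1.adicCompletion L)) *ᵥ Pi.single 0 1 with hy₀
  set y₁ : Fin 2 → w.1.adicCompletion L :=
    ((T⁻¹ : GL (Fin 2) (w.1.adicCompletion L)) : Matrix (Fin 2) (Fin 2) (w.1.adicCompletion L)) *ᵥ Pi.single 1 1 with hy₁
  -- the `W`-unit `a` read in `L_w`: non-zero and `σ_w`-fixed
  set aw : w.1.adicCompletion L := ((algebraMap (Fp L) L (a : Fp L) : L) : w.1.adicCompletion L) with haw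
  have haL : (algebraMap (Fp L) L (a : Fp L) : L) ≠ 0 := (map_ne_zero _).2 a.ne_zero
  have haw0 : aw ≠ 0 := by
    have h := (map_ne_zero (algebraMap L (w.1.adicCompletion L))).2 haL
    simpa only [HeightOneSpectrum.algebraMap_adicCompletion, Function.comp_apply, Algebra.algebraMap_self, RingHom.id_apply] using h
  have hσa : σ aw = aw := by rw [hσ, haw, galAdicCompletionMap_algebraMap]
  -- the lift `z ↦ z ⊗ 1_W` of a `w`-vector to `S^{n'}` and equality through the `w`-component
  let up : (Fin 2 → w.1.adicCompletion L) → (Fin n' → UnitaryGroup.LocalRing L v) := fun z b =>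
    Pi.single (M := fun w' : UnitaryGroup.PlacesOver L v => w'.1.adicCompletion L) w (z (e₁.symm b).1)
  have hup : ∀ z b, up z b w = z (e₁.symm b).1 := fun z b =>
    Pi.single_eq_same (M := fun w' : UnitaryGroup.PlacesOver L v => w'.1.adicCompletion L) w _
  have hupw : ∀ z, (fun b => up z b w) = fun b => z (e₁.symm b).1 := fun z => funext (hup z)
  have hveq : ∀ Y Y' : Fin n' → UnitaryGroup.LocalRing L v, (∀ b, Y b w = Y' b w) → Y = Y' := fun Y Y' h =>
    funext fun b => (LocalRing.eq_iff_apply_eq (IsCMField.complexConj L) hc w hw _ _).2 (h b)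
  -- the Gram matrix read at `w`: `reindex e₁ (diag(dV)_w ⊗ (a)) = reindex e₁ ((σT)ᵀ antidiag T ⊗ (a))`
  have hW1 : UnitaryGroup.placeForm (JW (Fp L) L a) w.1 = Matrix.of fun _ _ : Fin 1 => aw := by
    refine Matrix.ext fun i j => ?_
    fin_cases i; fin_cases j
    simp only [UnitaryGroup.placeForm, JW_eq, TW, Matrix.map_apply, Matrix.of_apply, Matrix.cons_val', Matrix.cons_val_fin_one,
      Matrix.empty_val', HeightOneSpectrum.algebraMap_adicCompletion, Function.comp_apply, Algebra.algebraMap_self, RingHom.id_apply, haw]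
  have hG : (gramS (Fp L) L v n' (gram (Fp L) e₁ (realDiagonal L dV hdV) (TW (Fp L) a))).map
      (Pi.evalRingHom (fun w' : UnitaryGroup.PlacesOver L v => w'.1.adicCompletion L) w) =
      Matrix.reindex e₁ e₁ (formCongr σ T ((StdForm.antidiagonal 2).over (w.1.adicCompletion L)) ⊗ₖ (Matrix.of fun _ _ : Fin 1 => aw)) := by
    rw [gramS_map_evalRingHom, ← reindex_kronecker_eq_gram_map (Fp L) L e₁ (realDiagonal_map L dV hdV).symm (JW_eq (Fp L) L a),
      UnitaryGroup.placeForm_reindex_kronecker, hTJ, hW1]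
  -- the pairing of two lifts read at `w`
  have hform : ∀ z z' : Fin 2 → w.1.adicCompletion L,
      hermForm (conjLocal L (IsCMField.complexConj L) v) (gramS (Fp L) L v n' (gram (Fp L) e₁ (realDiagonal L dV hdV) (TW (Fp L) a)))
        (up z) (up z') w = aw * hermForm σ (formCongr σ T ((StdForm.antidiagonal 2).over (w.1.adicCompletion L))) z z' := by
    intro z z'
    rw [apply_hermForm_of_smul_eq (IsCMField.complexConj L) v w hc hw, hG, hupw, hupw, hermForm_reindex_kronecker_lift]
  -- the hyperbolic values of the frame and the scalar rules
  have h00 : hermForm σ (formCongr σ T ((StdForm.antidiagonal 2).over (w.1.adicCompletion L))) y₀ y₀ = 0 := by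
    rw [hy₀, hermForm_formCongr_frameVec, StdForm.antidiagonal_over_apply, if_neg (by decide)]
  have h01 : hermForm σ (formCongr σ T ((StdForm.antidiagonal 2).over (w.1.adicCompletion L))) y₀ y₁ = 1 := by
    rw [hy₀, hy₁, hermForm_formCongr_frameVec, StdForm.antidiagonal_over_apply, if_pos (by decide)]
  have h10 : hermForm σ (formCongr σ T ((StdForm.antidiagonal 2).over (w.1.adicCompletion L))) y₁ y₀ = 1 := by
    rw [hy₀, hy₁, hermForm_formCongr_frameVec, StdForm.antidiagonal_over_apply, if_pos (by decide)]
  have hsr : ∀ (H : Matrix (Fin 2) (Fin 2) (w.1.adicCompletion L)) (r : w.1.adicCompletion L) (x z : Fin 2 → w.1.adicCompletion L),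
      hermForm σ H x (r • z) = r * hermForm σ H x z := fun H r x z => by
    rw [hermForm_apply, hermForm_apply, Matrix.mulVec_smul, dotProduct_smul, smul_eq_mul]
  have hsl : ∀ (H : Matrix (Fin 2) (Fin 2) (w.1.adicCompletion L)) (r : w.1.adicCompletion L) (x z : Fin 2 → w.1.adicCompletion L),
      hermForm σ H (r • x) z = σ r * hermForm σ H x z := fun H r x z => by
    have h1 : (σ : _ → _) ∘ (r • x) = σ r • ((σ : _ → _) ∘ x) := funext fun k => by simp
    rw [hermForm_apply, hermForm_apply, h1, smul_dotProduct, smul_eq_mul]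
  refine ⟨Xp, X0, hX, hcp, hc0, up y₀, up (aw⁻¹ • y₁),
    Pi.single (M := fun w' : UnitaryGroup.PlacesOver L v => w'.1.adicCompletion L) w ϖ,
    Pi.single (M := fun w' : UnitaryGroup.PlacesOver L v => w'.1.adicCompletion L) w ϖ⁻¹, ?_, ?_, ?_, ?_,
    Pi.single_eq_same (M := fun w' : UnitaryGroup.PlacesOver L v => w'.1.adicCompletion L) w ϖ,
    Pi.single_eq_same (M := fun w' : UnitaryGroup.PlacesOver L v => w'.1.adicCompletion L) w ϖ⁻¹, ?_, ?_, ?_⟩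
  · -- `h(y,y) = 0`
    rw [LocalRing.eq_iff_apply_eq (IsCMField.complexConj L) hc w hw, hform, h00, mul_zero]; rfl
  · -- `h(y*,y) = 1`
    rw [LocalRing.eq_iff_apply_eq (IsCMField.complexConj L) hc w hw, hform, hsl, h10, mul_one, map_inv₀, hσa, mul_inv_cancel₀ haw0]; rfl
  · -- `h(y,y*) = 1`
    rw [LocalRing.eq_iff_apply_eq (IsCMField.complexConj L) hc w hw, hform, hsr, h01, mul_one, mul_inv_cancel₀ haw0]; rfl
  · -- `y^⊥ = S·y`
    intro bb hbb
    -- the `w`-component of `bb` is the lift of `β i := bb_{e₁(i,0), w}`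
    set β : Fin 2 → w.1.adicCompletion L := fun i => bb (e₁ (i, 0)) w with hβdef
    have hb : ∀ b : Fin n', b = e₁ ((e₁.symm b).1, 0) := fun b => by
      conv_lhs => rw [← e₁.apply_symm_apply b]
      exact congrArg e₁ (Prod.ext rfl (Subsingleton.elim _ _))
    have hbβ : (fun b => bb b w) = fun b => β (e₁.symm b).1 := funext fun b => congrArg (fun k => bb k w) (hb b)
    have hw0 : hermForm (conjLocal L (IsCMField.complexConj L) v)
        (gramS (Fp L) L v n' (gram (Fp L) e₁ (realDiagonal L dV hdV) (TW (Fp L) a))) (up y₀) bb w = 0 := by rw [hbb]; rfl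
    rw [apply_hermForm_of_smul_eq (IsCMField.complexConj L) v w hc hw, hG, hupw, hbβ, hermForm_reindex_kronecker_lift] at hw0
    have hβ0 : hermForm σ (formCongr σ T ((StdForm.antidiagonal 2).over (w.1.adicCompletion L))) y₀ β = 0 :=
      (mul_eq_zero.1 hw0).resolve_left haw0
    rw [hy₀] at hβ0
    have hβ := eq_smul_frameVec_of_hermForm_eq_zero σ T β hβ0
    refine ⟨Pi.single (M := fun w' : UnitaryGroup.PlacesOver L v => w'.1.adicCompletion L) w
      (((T : Matrix (Fin 2) (Fin 2) (w.1.adicCompletion L)) *ᵥ β) 0), hveq _ _ fun b => ?_⟩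
    rw [congrFun hbβ b]
    simp only [Pi.smul_apply, smul_eq_mul, Pi.mul_apply]
    rw [Pi.single_eq_same, hup]
    conv_lhs => rw [hβ]
    rw [Pi.smul_apply, smul_eq_mul, hy₀]
  · -- `x ∈ X₊`: `(x ⊗ 1) y = α₊ y`
    intro x hx
    refine hveq _ _ fun b => ?_
    rw [apply_mulVec_localLineInl, hupw, reindex_kronecker_one_mulVec_lift]
    dsimp only
    rw [hXp x hx]
    simp only [Pi.smul_apply, smul_eq_mul, Pi.mul_apply]
    rw [Pi.single_eq_same, hup]
  · -- `x ∈ X₀`: `(x ⊗ 1) y = y`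
    intro x hx
    rw [one_smul]
    refine hveq _ _ fun b => ?_
    rw [apply_mulVec_localLineInl, hupw, reindex_kronecker_one_mulVec_lift]
    dsimp only
    rw [hX0 x hx, hup]
  · -- `t₁⁻¹`: `(t₁⁻¹ ⊗ 1) y = α₋ y`
    refine hveq _ _ fun b => ?_
    rw [apply_mulVec_localLineInl, hupw, reindex_kronecker_one_mulVec_lift]
    dsimp only
    rw [show ((t₁⁻¹ : UnitaryGroup.localPi L (IsCMField.complexConj L) 2 (Matrix.diagonal dV) v) : UnitaryGroup.LocalGLPi L 2 v) w =
        (t₁ : UnitaryGroup.LocalGLPi L 2 v)⁻¹ w from rfl, hti]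
    simp only [Pi.smul_apply, smul_eq_mul, Pi.mul_apply]
    rw [Pi.single_eq_same, hup]

end Inert

end Summit.HodgeConjecture.HodgeConjecture.Cruxes.HLiu418.K2LiuInertFrameInputs

end
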